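import Summits.BirchSwinnertonDyer.Rank1Residual.ManinAdditive.TwistOrbitAtTwoA3EvenDegree
import Literature.NumberTheory.EllipticCurves.ManinConstantQuadraticTwistAtTwoProofs
import Literature.NumberTheory.EllipticCurves.ModularDegreeQuadraticTwistValuation
import Literature.NumberTheory.EllipticCurves.ManinConstantQuadraticTwistAtTwoOrdinaryProofs
import HarnessLib

/-!
# Twist-orbit transport of the Manin constant — ADD-ON part 4/4 (`TwistOrbitAtTwoA4ExactAtTwo`) to the typer's landing of T-an-6 (files F1–F3 =
# HOME/an/Sketch-an4v5.lean 2d253c8874352f93): the prime-2 theorems THM I′, E-an-18r, S-an-14, E-an-20, E-an-21,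
# the E-an-17 degree dichotomy at odd `q`, and the closed `(q*, q, q²)` obligations (§§9–14 of the planner's
# leaf HOME/an/Leaf-TwistOrbitManinTransport.lean f491d1e88c8dc766, VERBATIM).

PROVENANCE / HOW TO LAND. Cell `bsd-f2-manin`, planner `bsd-f2-manin-an` g3. This file = exactly the
declarations of the leaf f491d1e88c8dc766 that are NOT in Sketch-an4v5 (the typer's F1–F3 source), in leaf
order, importing F1–F3 under the module names the typer announced (STATUS 18:40Z: `TwistOrbitManinStatements`
(p556717), `TwistOrbitDegreeIdentity`, `TwistOrbitManinTransportProof`) — adjust the three `import Summits.…`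
lines to the landed names. It was compiled on the farm as HOME/an/Addon-AtTwo-simulated.lean (= Sketch-an4v5
body with the cell namespace + this body): rc 0 · 0 err · 0 warn · 0 sorries; audit ok. It needs from F1–F3
only: `not_good_and_not_mult_of_sq_dvd_conductorNorm`, `u_sq_eq_one_of_smul_quadraticTwist_of_Δ`,
`deg_mul_c_sq_eq_of_pStar`, `maninConstant_dvd_mul_of_charTwist_gamma0`, `twistOrbitManinTransport_pStar`,
`commutingOrbitManinChain_pStar`, `orbitDegreeManinIdentity_pStar`, `maninEqOfNotDvdDegree_pStar_holds`,
`flipOrbitManinEq_pStar`, `twistPartnerDegreeBound_pStar`, `twistMinimalDegreeRoadTransport_pStar`,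
`orbitManinDefectLeOne_pStar`, the statement schemas, and `natAbs_eq_and_deg_eq_of_chain`; if the typer renamed
any of them (dedup), rename here too.  Split for the 400-line rule at the `section` boundaries
(`OddDichotomy` | `Closed` | `EvenTwist`+`ClosedEven` | `EvenDegree`+`ClosedEvenDegree` | `ExactAtTwo`).

RESULTS (all kernel-checked, no `sorry`, every `@[conjecture] def` closed by a hypothesis-free `_holds` or a
generic `_of_` theorem; statements, census numbers and references: the leaf's module docstring and
HOME/MEMO-an.md §§27–39; HOME/CANDIDATES.md rows E-an-17, E-an-18/18c/18v, E-an-18r/S-an-14, E-an-20, E-an-21).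
-/

noncomputable section

open scoped MatrixGroups ModularForm

open CongruenceSubgroup WeierstrassCurve
  Literature.NumberTheory.DiophantineGeometry
  Literature.NumberTheory.EllipticCurves
  Literature.NumberTheory.EllipticCurves.ModularForms

namespace Summit.BirchSwinnertonDyer.Rank1Residual.ManinAdditive

section ClosedEvenDegree

/-! ## §13 Closed obligations for §12 -/

/-- **S-an-14 at `χ₋₄`.** -/
@[conjecture] def EvenCommutingOrbitDegreeIdentityNegOne : Prop := EvenCommutingOrbitDegreeIdentity (-1) 4
/-- `evenCommutingOrbitDegreeIdentityNegOne_holds`: the kernel-checked instance closing the statement above (hypothesis-free). -/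
theorem evenCommutingOrbitDegreeIdentityNegOne_holds : EvenCommutingOrbitDegreeIdentityNegOne :=
  evenCommuting_negOne.1

/-- **S-an-14 at `χ₈`.** -/
@[conjecture] def EvenCommutingOrbitDegreeIdentityTwo : Prop := EvenCommutingOrbitDegreeIdentity 2 8
/-- `evenCommutingOrbitDegreeIdentityTwo_holds`: the kernel-checked instance closing the statement above (hypothesis-free). -/
theorem evenCommutingOrbitDegreeIdentityTwo_holds : EvenCommutingOrbitDegreeIdentityTwo :=
  evenCommuting_two.1

/-- **S-an-14 at `χ₋₈`.** -/
@[conjecture] def EvenCommutingOrbitDegreeIdentityNegTwo : Prop := EvenCommutingOrbitDegreeIdentity (-2) 8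
/-- `evenCommutingOrbitDegreeIdentityNegTwo_holds`: the kernel-checked instance closing the statement above (hypothesis-free). -/
theorem evenCommutingOrbitDegreeIdentityNegTwo_holds : EvenCommutingOrbitDegreeIdentityNegTwo :=
  evenCommuting_negTwo.1

/-- **E-an-18r at `χ₋₄`** (`c′ ∣ 2c ∣ 4c′` on commuting orbits). -/
@[conjecture] def EvenCommutingOrbitManinChainNegOne : Prop := EvenCommutingOrbitManinChain (-1) 4
/-- `evenCommutingOrbitManinChainNegOne_holds`: the kernel-checked instance closing the statement above (hypothesis-free). -/
theorem evenCommutingOrbitManinChainNegOne_holds : EvenCommutingOrbitManinChainNegOne :=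
  evenCommuting_negOne.2

/-- **E-an-18r at `χ₈`** (`c′ ∣ 2c ∣ 8c′`). -/
@[conjecture] def EvenCommutingOrbitManinChainTwo : Prop := EvenCommutingOrbitManinChain 2 8
/-- `evenCommutingOrbitManinChainTwo_holds`: the kernel-checked instance closing the statement above (hypothesis-free). -/
theorem evenCommutingOrbitManinChainTwo_holds : EvenCommutingOrbitManinChainTwo :=
  evenCommuting_two.2

/-- **E-an-18r at `χ₋₈`** (`c′ ∣ 2c ∣ 8c′`). -/
@[conjecture] def EvenCommutingOrbitManinChainNegTwo : Prop := EvenCommutingOrbitManinChain (-2) 8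
/-- `evenCommutingOrbitManinChainNegTwo_holds`: the kernel-checked instance closing the statement above (hypothesis-free). -/
theorem evenCommutingOrbitManinChainNegTwo_holds : EvenCommutingOrbitManinChainNegTwo :=
  evenCommuting_negTwo.2

/-- **E-an-20 at `χ₈`** — a THEOREM (E-an-18r at `(2, 8)`: `c′ ∣ 2c`, `c ∣ 4c′`; S-an-14 with
`|d| = 2`; `deg′·4^i = 8·deg`, `i ≤ 3`). -/
@[conjecture] def TwoCommutingOrbitDegreeTetrachotomyTwo : Prop := TwoCommutingOrbitDegreeTetrachotomy 2
/-- `twoCommutingOrbitDegreeTetrachotomyTwo_holds`: the kernel-checked instance closing the statement above (hypothesis-free). -/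
theorem twoCommutingOrbitDegreeTetrachotomyTwo_holds : TwoCommutingOrbitDegreeTetrachotomyTwo := by
  intro W W' _ _ _ _ _ _ u D D' hM hN hu hD hD' hΔ
  obtain ⟨hI, hC⟩ := evenCommuting_two
  have hId := hI W W' u D D' hM hN hu hΔ
  obtain ⟨h1, h2⟩ := hC W W' u D D' hM hN hu hD hD' hΔ
  have hc : D.c ≠ 0 := D.maninConstant_ne_zero_holds
  have hc' : D'.c ≠ 0 := D'.maninConstant_ne_zero_holds
  have hId' : (D'.modularDegree : ℤ) * D.c ^ 2 = ((2 : ℕ) : ℤ) * D.modularDegree * D'.c ^ 2 := by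
    rw [Nat.cast_ofNat]; rw [show |(2 : ℤ)| = 2 by norm_num] at hId; exact hId
  have h2' : D.c ∣ 2 ^ 2 * D'.c := by
    rw [show (2 : ℤ) * 2 * D'.c = 2 ^ 2 * D'.c by ring] at h2; exact h2
  refine ⟨?_, deg_eq_iff_c_sq_eq hc D.deg_pos.ne' two_ne_zero hId'⟩
  obtain ⟨i, hi, hdeg⟩ := exists_deg_mul_four_pow_eq hc hc' h1 h2' hId'
  interval_cases i <;> omega

/-- **E-an-20 at `χ₋₈`** — a THEOREM (as at `χ₈`, `c ∣ −4c′`). -/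
@[conjecture] def TwoCommutingOrbitDegreeTetrachotomyNegTwo : Prop :=
  TwoCommutingOrbitDegreeTetrachotomy (-2)
/-- `twoCommutingOrbitDegreeTetrachotomyNegTwo_holds`: the kernel-checked instance closing the statement above (hypothesis-free). -/
theorem twoCommutingOrbitDegreeTetrachotomyNegTwo_holds : TwoCommutingOrbitDegreeTetrachotomyNegTwo := by
  intro W W' _ _ _ _ _ _ u D D' hM hN hu hD hD' hΔ
  obtain ⟨hI, hC⟩ := evenCommuting_negTwo
  have hId := hI W W' u D D' hM hN hu hΔ
  obtain ⟨h1, h2⟩ := hC W W' u D D' hM hN hu hD hD' hΔ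
  have hc : D.c ≠ 0 := D.maninConstant_ne_zero_holds
  have hc' : D'.c ≠ 0 := D'.maninConstant_ne_zero_holds
  have hId' : (D'.modularDegree : ℤ) * D.c ^ 2 = ((2 : ℕ) : ℤ) * D.modularDegree * D'.c ^ 2 := by
    rw [Nat.cast_ofNat]; rw [show |(-2 : ℤ)| = 2 by norm_num] at hId; exact hId
  have h2' : D.c ∣ 2 ^ 2 * D'.c := by
    rw [show (2 : ℤ) * (-2) * D'.c = -(2 ^ 2 * D'.c) by ring, dvd_neg] at h2; exact h2
  refine ⟨?_, deg_eq_iff_c_sq_eq hc D.deg_pos.ne' two_ne_zero hId'⟩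
  obtain ⟨i, hi, hdeg⟩ := exists_deg_mul_four_pow_eq hc hc' h1 h2' hId'
  interval_cases i <;> omega

end ClosedEvenDegree

section ExactAtTwo

/-! ## §14 E-an-21: EXACT Manin transport `c′ = ±c` and DEGREE EQUALITY on the `χ₋₄`-orbit
## `(W₁ ⊗ χ₈, W₁ ⊗ χ₋₈)` of a curve `W₁` semistable at `2` in Stevens' case `η = 1`

THEOREM I′ gives `c′ ∣ 2c ∣ 4c′` (§12); the tree's `η = 1` theorem
`not_dvd_maninConstant_of_isTwistOfSemistableAtTwo_etaOne_gamma0` (modulo the by-name Manin facts of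
Mazur, Abbes–Ullmo, Česnavičius and modularity) gives `2 ∤ c`, `2 ∤ c′` when `W ~ W₁ ⊗ χ₈`,
`W′ ~ W₁ ⊗ χ₋₈` with `W₁` semistable at `2` and `2 ∣ N(W₁) ∨ a₂(W₁)` odd; together `c′ = ±c` EXACTLY,
and then S-an-14 forces `deg φ_{W′} = deg φ_W`.  Census (an/g3-ean21.out 083bd3207a36a765; sources
`N(W₁) ≤ 7 812`, targets `2⁶ ∥ N < 5·10⁵`): `η = 1`: 3 570 orbits, `deg′ = deg` on 3 570 / 3 570
(`η = 2`, where oddness is the open E-an-1: 3 521 / 3 521). -/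

/-- **E-an-21 `ExactManinTransportOfTwistsOfSemistableAtTwo`** (modulo the by-name Manin facts
`hM hAU hC2 hnf`, exactly as E-an-1/E-an-2 are stated): `W₁` globally minimal, semistable at `2`
(`4 ∤ N(W₁)`), `2 ∣ N(W₁) ∨ a₂(W₁)` odd (Stevens `η = 1`); `W ~ W₁ ⊗ χ₈`, `W′ ~ W₁ ⊗ χ₋₈` globally
minimal with `N(W₁) ∣ N(W)`, `8² ∣ N(W) = N(W′)`, `u • (W ⊗ χ₋₄) = W′`, `Δ(W′) = Δ(W)`, lattice-optimal
data `D`, `D′` ⇒ **`c(D′) = ±c(D)` and `deg φ_{W′} = deg φ_W`**.  PROVED below; beyond print (the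
printed identity is only `deg′c² = deg·c′²`).  Why it might fail: it cannot (theorem); the open
complement is `η = 2` (E-an-1). [cite: Stevens1989, Lemma (5.4)] [cite: Cesnavicius2018, Thm. 1.2]
[cite: Watkins2002, §2.1 (p. 491)] -/
@[conjecture] def ExactManinTransportOfTwistsOfSemistableAtTwo : Prop :=
  ∀ (_hM : mazur_not_dvd_maninConstant_of_odd)
    (_hAU : abbesUllmo_not_dvd_maninConstant_of_not_dvd_level)
    (_hC2 : cesnavicius_not_two_dvd_maninConstant_of_two_dvd_level) (_hnf : exists_isNewformOf)
    (W₁ : WeierstrassCurve ℚ) [W₁.IsElliptic] [W₁.IsGloballyMinimal]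
    (W W' : WeierstrassCurve ℚ) [W.IsElliptic] [W.IsGloballyMinimal] [W'.IsElliptic]
    [W'.IsGloballyMinimal] [NeZero (W.conductorNorm ℤ)] [NeZero (W'.conductorNorm ℤ)]
    (u : VariableChange ℚ) (D : ModularParametrizationData W (W.conductorNorm ℤ))
    (D' : ModularParametrizationData W' (W'.conductorNorm ℤ)),
    ¬ 2 ^ 2 ∣ W₁.conductorNorm ℤ → (2 ∣ W₁.conductorNorm ℤ ∨ Odd (W₁.LFunction 2)) →
    WeierstrassCurve.IsIsogenous W (W₁.quadraticTwist ((2 : ℤ) : ℚ)) →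
    WeierstrassCurve.IsIsogenous W' (W₁.quadraticTwist ((-2 : ℤ) : ℚ)) →
    W₁.conductorNorm ℤ ∣ W.conductorNorm ℤ → 8 ^ 2 ∣ W.conductorNorm ℤ →
    W'.conductorNorm ℤ = W.conductorNorm ℤ → u • W.quadraticTwist (-1 : ℚ) = W' → W'.Δ = W.Δ →
    (∀ z ∈ D.L.lattice, ∃ w ∈ periodLattice D.f, z = D.c * w) →
    (∀ z ∈ D'.L.lattice, ∃ w ∈ periodLattice D'.f, z = D'.c * w) →
    (D'.c = D.c ∨ D'.c = -D.c) ∧ D'.modularDegree = D.modularDegree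

/-- **E-an-21 is a THEOREM** (tree `η = 1` theorem twice + E-an-18r at `χ₋₄` + E-an-20). -/
theorem exactManinTransportOfTwistsOfSemistableAtTwo_holds :
    ExactManinTransportOfTwistsOfSemistableAtTwo := by
  intro hM hAU hC2 hnf W₁ _ _ W W' _ _ _ _ _ _ u D D' h4N₁ hη htw htw' hN₁N h64 hN hu hΔ hD hD'
  haveI : Fact (Nat.Prime 2) := ⟨Nat.prime_two⟩
  have h64' : 8 ^ 2 ∣ W'.conductorNorm ℤ := by rw [hN]; exact h64
  have hN₁N' : W₁.conductorNorm ℤ ∣ W'.conductorNorm ℤ := by rw [hN]; exact hN₁N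
  have h4 : 2 ^ 2 ∣ W.conductorNorm ℤ := dvd_trans (by norm_num) h64
  have h4' : 2 ^ 2 ∣ W'.conductorNorm ℤ := dvd_trans (by norm_num) h64'
  have h16 : 4 ^ 2 ∣ W.conductorNorm ℤ := dvd_trans (by norm_num) h64
  have hadd := not_good_and_not_mult_of_sq_dvd_conductorNorm W h4
  have hadd' := not_good_and_not_mult_of_sq_dvd_conductorNorm W' h4'
  have hmN : (4 * (2 : ℤ).natAbs) ^ 2 ∣ W.conductorNorm ℤ := by simpa using h64
  have hmN' : (4 * (-2 : ℤ).natAbs) ^ 2 ∣ W'.conductorNorm ℤ := by simpa using h64'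
  have hodd : ¬ (2 : ℤ) ∣ D.c :=
    not_dvd_maninConstant_of_isTwistOfSemistableAtTwo_etaOne_gamma0 hM hAU hC2 hnf (d := 2)
      (Or.inr (Or.inl rfl)) htw hN₁N hmN h4N₁ (Or.inr hη) hadd W D
      (WeierstrassCurve.isIsogenous_self W) hD
  have hodd' : ¬ (2 : ℤ) ∣ D'.c :=
    not_dvd_maninConstant_of_isTwistOfSemistableAtTwo_etaOne_gamma0 hM hAU hC2 hnf (d := -2)
      (Or.inr (Or.inr rfl)) htw' hN₁N' hmN' h4N₁ (Or.inr hη) hadd' W' D'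
      (WeierstrassCurve.isIsogenous_self W') hD'
  have hu' : u • W.quadraticTwist (((-1 : ℤ) : ℤ) : ℚ) = W' := by simpa using hu
  have hΔ' : W'.Δ = (((-1 : ℤ) : ℤ) : ℚ) ^ 6 * W.Δ := by rw [hΔ]; norm_num
  obtain ⟨h1, h2⟩ := evenCommuting_negOne.2 W W' u D D' h16 hN hu' hD hD' hΔ'
  have h2n : D.c ∣ 2 * (-D'.c) := by
    rw [show (2 : ℤ) * (-1 : ℤ) * D'.c = 2 * (-D'.c) by ring] at h2; exact h2
  have hg' : Int.gcd D'.c 2 = 1 :=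
    Int.isCoprime_iff_gcd_eq_one.mp (Int.prime_two.irreducible.coprime_iff_not_dvd.mpr hodd').symm
  have hg : Int.gcd D.c 2 = 1 :=
    Int.isCoprime_iff_gcd_eq_one.mp (Int.prime_two.irreducible.coprime_iff_not_dvd.mpr hodd).symm
  have h1' : D'.c ∣ D.c := Int.dvd_of_dvd_mul_right_of_gcd_one h1 hg'
  have h2' : D.c ∣ D'.c := dvd_neg.mp (Int.dvd_of_dvd_mul_right_of_gcd_one h2n hg)
  have habs : D'.c.natAbs = D.c.natAbs := Int.natAbs_eq_of_dvd_dvd h1' h2'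
  have hcc : D'.c = D.c ∨ D'.c = -D.c := Int.natAbs_eq_natAbs_iff.mp habs
  refine ⟨hcc, ?_⟩
  have hsq : D'.c ^ 2 = D.c ^ 2 := by rcases hcc with h | h <;> simp [h]
  exact (negOneCommutingOrbitDegreeTrichotomy_holds W W' u D D' h16 hN hu hD hD' hΔ).2.mpr hsq

end ExactAtTwo

end Summit.BirchSwinnertonDyer.Rank1Residual.ManinAdditive

end
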